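import Summits.AtomisticToContinuum.HydrodynamicLimit.Theorems.PreShockDoorScaling
import Summits.AtomisticToContinuum.HydrodynamicLimit.Theorems.PreShockDoorHelpers
import Literature.MathematicalPhysics.KineticTheory.HardSphereEulerClassicalUniqueness
import HarnessLib

/-!
# PreShockDoor · part D — the door kernel `preShockHomotopy_of : [WD] → [E] → [S] → [I] → PreShockHomotopy`
and `preShockHomotopy_door : [WD] → [S] → PreShockHomotopy` (decomp-a2c lens-1 g40 node, critic rows
546/549; `[E]`, `[I]` proved in parts B, A; the node's by-value input `[U]` is the tree theorem
`hsEuler_uniqueness_smallPacking`, used by name). Density data `d_m = (1-m)·1 + m ρ(0,·)` (mass one ⇒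
hull constant `Λ = 1`); members `κ ≤ 5/8`: slowed `[WD]`-family; `κ > 5/8`: cool-and-slow scalings of
the TARGET, glued by classical uniqueness on a short small-packing window. 0 sorry; default heartbeats.
-/

noncomputable section

open Set Filter MeasureTheory
open scoped Topology ContDiff ENNReal
open Literature.MathematicalPhysics.KineticTheory Literature.Analysis.FunctionSpaces

namespace Summit.AtomisticToContinuum.HydrodynamicLimit.Theorems.PreShockDoor

/-- **Door kernel (PROVED).** The four pieces imply the route crux `OneSphereInfluence.PreShockHomotopy`
(stmt-AtomisticToContinuum-13621), with `Λ = 1`; classical uniqueness at small packing is the tree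
theorem `hsEuler_uniqueness_smallPacking` (Dafermos Thm 5.2.1), used by name. -/
theorem preShockHomotopy_of (hWD : SmoothFamilyWellposedness) (hSc : CoolSlowScaling)
    (hSt : LocalEosStatics) (hId : LLNDataIdentification) :
    Summit.AtomisticToContinuum.HydrodynamicLimit.Theses.OneSphereInfluence.PreShockHomotopy := by
  intro a₁ θ₁ u₁ ha₁c hθ₁c hu₁c ha₁ hθ₁
  -- Step 0: activity bounds `B`, statics threshold, EoS, thresholds
  obtain ⟨B, xalo, xahi, hB1, hab, haB⟩ := exists_activity_bounds ha₁c ha₁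
  have hBpos : 0 < B := one_pos.trans_le hB1
  have hbddb : BddBelow (range a₁) := ⟨a₁ xalo, by rintro _ ⟨y, rfl⟩; exact (hab y).1⟩
  have hbdda : BddAbove (range a₁) := ⟨a₁ xahi, by rintro _ ⟨y, rfl⟩; exact (hab y).2⟩
  obtain ⟨σS, hσS, hS⟩ := hSt B hB1
  obtain ⟨η₀, hη₀, F, hFa, hFeq, -⟩ := hsEosLowDensity_proof
  obtain ⟨η₁W, hη₁W, hW⟩ := hWD η₀ hη₀ F hFa hFeq
  obtain ⟨η₁U, hη₁U, hU⟩ := hsEuler_uniqueness_smallPacking η₀ hη₀ F hFa hFeq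
  obtain ⟨η₁, hη₁_def⟩ : ∃ η₁ : ℝ, η₁ = min η₁W η₁U := ⟨_, rfl⟩
  have hη₁ : 0 < η₁ := hη₁_def ▸ lt_min hη₁W hη₁U
  have hη₁leW : η₁ ≤ η₁W := hη₁_def ▸ min_le_left _ _
  have hη₁leU : η₁ ≤ η₁U := hη₁_def ▸ min_le_right _ _
  refine ⟨1, le_rfl, min (min σS (1 / 2)) (η₁ / (8 * B ^ 2)),
    lt_min (lt_min hσS (by norm_num)) (by positivity), ?_⟩
  intro σ hσ hσlt T ρ θ u hE Φ hH0 t ht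
  have hσS' : σ < σS := hσlt.trans_le ((min_le_left _ _).trans (min_le_left _ _))
  have hσhalf : σ ≤ 1 / 2 := (hσlt.trans_le ((min_le_left _ _).trans (min_le_right _ _))).le
  have hση : σ < η₁ / (8 * B ^ 2) := hσlt.trans_le (min_le_right _ _)
  have hσ3pos : 0 < σ ^ 3 := pow_pos hσ 3
  have hB2 : 0 < B ^ 2 := pow_pos hBpos 2
  have hσ3 : 4 * B ^ 2 * σ ^ 3 ≤ η₁ / 2 := packing_le_half hσ hσhalf hBpos hση
  have hT : 0 < T := ht.1.trans_lt ht.2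
  -- Step 1: statics at `σ`, identification of the target data
  obtain ⟨G, Ginv, hGs, hGinvs, hGmono, hGinvG, hGGinv, hprof⟩ := hS σ hσ hσS'
  obtain ⟨μ₁, hμ₁int, hμ₁rng, hμ₁le, hμ₁lln⟩ := hprof a₁ θ₁ u₁ ha₁c hθ₁c hu₁c haB hθ₁
  have hGc : ContinuousOn G (Icc 0 (8 * B ^ 2)) :=
    hGs.continuousOn.mono fun z hz => ⟨by linarith only [hz.1], by linarith only [hz.2, hB2]⟩
  have h2B8 : 2 * B ^ 2 ≤ 8 * B ^ 2 := by linarith only [hB2]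
  have h4B8 : 4 * B ^ 2 ≤ 8 * B ^ 2 := by linarith only [hB2]
  have hρG_cont : Continuous fun x => G (Real.exp μ₁ * a₁ x) :=
    hGc.comp_continuous (continuous_const.mul ha₁c)
      fun x => ⟨(hμ₁rng x).1, (hμ₁rng x).2.trans h2B8⟩
  have h0T : (0:ℝ) ∈ Ico 0 T := ⟨le_rfl, hT⟩
  obtain ⟨hsρ0, hsu0, hsθ0⟩ := isHardSphereEulerSolution_isSmooth_slice hE h0T
  have hρ₀pos : ∀ x, 0 < ρ 0 x := fun x => hE.density_pos 0 h0T x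
  obtain ⟨hρ0, hu0, hθ0⟩ := hId σ Φ (fun N => localGibbsLaw σ a₁ u₁ θ₁ N (Φ N))
    (fun N => isProbabilityMeasure_localGibbsLaw ha₁c hθ₁c hu₁c ha₁ hθ₁ hσhalf N (Φ N))
    ρ θ (fun _ x => G (Real.exp μ₁ * a₁ x)) (fun _ => θ₁) u (fun _ => u₁)
    hsρ0.continuous hsu0.continuous hsθ0.continuous hρG_cont hu₁c hθ₁c hρ₀pos hH0 (hμ₁lln Φ)
  have hρ₀G : ∀ x, ρ 0 x = G (Real.exp μ₁ * a₁ x) := fun x => congrFun hρ0 x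
  have hu0' : u 0 = u₁ := hu0
  have hθ0' : θ 0 = θ₁ := hθ0
  have hu₁s : Torus.IsSmooth u₁ := hu0' ▸ hsu0
  have hθ₁s : Torus.IsSmooth θ₁ := hθ0' ▸ hsθ0
  have hρ₀c : Continuous (ρ 0) := hsρ0.continuous
  have hρ₀int : ∫ x, ρ 0 x = 1 := by
    rw [show ρ 0 = fun x => G (Real.exp μ₁ * a₁ x) from hρ0]; exact hμ₁int
  have hρ₀le : ∀ x, ρ 0 x ≤ 4 * B ^ 2 := fun x => by rw [hρ₀G]; exact hμ₁le x
  obtain ⟨xlo, xhi, hρb⟩ := exists_min_max hρ₀c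
  obtain ⟨hlo1, hhi1⟩ := min_le_one_le_max hρ₀c hρ₀int hρb
  have hρloI : ρ 0 xlo ∈ Icc (0:ℝ) (4 * B ^ 2) := ⟨(hρ₀pos xlo).le, hρ₀le xlo⟩
  have hρhiI : ρ 0 xhi ∈ Icc (0:ℝ) (4 * B ^ 2) := ⟨(hρ₀pos xhi).le, hρ₀le xhi⟩
  -- Step 2: unscaled interpolation data and the smooth family `V` of [WD]
  obtain ⟨dd, hdd_def⟩ : ∃ dd : ℝ → T3 → ℝ, dd = fun m x => (1 - m) + m * ρ 0 x := ⟨_, rfl⟩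
  obtain ⟨uu, huu_def⟩ : ∃ uu : ℝ → T3 → V3, uu = fun m x => m • u₁ x := ⟨_, rfl⟩
  obtain ⟨tt, htt_def⟩ : ∃ tt : ℝ → T3 → ℝ, tt = fun m x => (1 - m) + m * θ₁ x := ⟨_, rfl⟩
  have hid : ContDiffOn ℝ ∞ (fun m : ℝ => m) (Icc 0 1) := contDiff_id.contDiffOn
  have h1m : ContDiffOn ℝ ∞ (fun m : ℝ => 1 - m) (Icc 0 1) := (contDiff_const.sub contDiff_id).contDiffOn
  have hdds : Torus.IsSmoothSpaceTimeOn (Icc 0 1) dd := by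
    rw [hdd_def]
    exact (Torus.isSmoothSpaceTimeOn_of_time h1m).add
      ((Torus.isSmoothSpaceTimeOn_of_time hid).mul (Torus.isSmoothSpaceTimeOn_const hsρ0 _))
  have htts : Torus.IsSmoothSpaceTimeOn (Icc 0 1) tt := by
    rw [htt_def]
    exact (Torus.isSmoothSpaceTimeOn_of_time h1m).add
      ((Torus.isSmoothSpaceTimeOn_of_time hid).mul (Torus.isSmoothSpaceTimeOn_const hθ₁s _))
  have huus : Torus.IsSmoothSpaceTimeOn (Icc 0 1) uu := by
    rw [huu_def]
    exact (Torus.isSmoothSpaceTimeOn_of_time hid).smul (Torus.isSmoothSpaceTimeOn_const hu₁s _)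
  have hddpos : ∀ m ∈ Icc (0:ℝ) 1, ∀ x, 0 < dd m x := fun m hm x => by
    rw [hdd_def]; exact convexComb_pos hm.1 hm.2 (hρ₀pos x)
  have httpos : ∀ m ∈ Icc (0:ℝ) 1, ∀ x, 0 < tt m x := fun m hm x => by
    rw [htt_def]; exact convexComb_pos hm.1 hm.2 (hθ₁ x)
  have hddb : ∀ m ∈ Icc (0:ℝ) 1, ∀ x, ρ 0 xlo ≤ dd m x ∧ dd m x ≤ ρ 0 xhi := fun m hm x => by
    rw [hdd_def]; exact convexComb_mem hm.1 hm.2 (hρb x).1 (hρb x).2 hlo1 hhi1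
  have hddpack : ∀ m ∈ Icc (0:ℝ) 1, ∀ x, dd m x * σ ^ 3 ≤ η₁W := fun m hm x =>
    packing_of_le ((hddb m hm x).2.trans (hρ₀le xhi)) hσ3pos hσ3 hη₁leW hη₁
  have hdd_int : ∀ m : ℝ, ∫ x, dd m x = 1 := fun m => by
    rw [hdd_def]; exact integral_convexComb_eq_one hρ₀c hρ₀int m
  have hdd1 : dd 1 = ρ 0 := by rw [hdd_def]; funext x; simp
  have hdd0 : dd 0 = fun _ => (1:ℝ) := by rw [hdd_def]; funext x; simp
  have huu1 : uu 1 = u₁ := by rw [huu_def]; funext x; simp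
  have huu0 : uu 0 = fun _ => (0:V3) := by rw [huu_def]; funext x; simp
  have htt1 : tt 1 = θ₁ := by rw [htt_def]; funext x; simp
  have htt0 : tt 0 = fun _ => (1:ℝ) := by rw [htt_def]; funext x; simp
  obtain ⟨Tst, hTst, V, θV, uV, hVsol, hVρs, hVus, hVθs⟩ :=
    hW σ hσ dd tt uu hdds htts huus hddpos httpos hddpack
  have h1I : (1:ℝ) ∈ Icc (0:ℝ) 1 := ⟨zero_le_one, le_rfl⟩
  have h0I : (0:ℝ) ∈ Icc (0:ℝ) 1 := ⟨le_rfl, zero_le_one⟩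
  obtain ⟨hV1sol, hV1ρ, hV1u, hV1θ⟩ := hVsol 1 h1I
  obtain ⟨hV0sol, hV0ρ, hV0u, hV0θ⟩ := hVsol 0 h0I
  -- Step 3: a common short time `T₂` of small packing; uniqueness identifications
  have hpack0 : ∀ x, ρ 0 x * σ ^ 3 ≤ η₁ / 2 := fun x => by
    have := mul_le_mul_of_nonneg_right (hρ₀le x) hσ3pos.le; linarith only [this, hσ3]
  have hη₁half : η₁ / 2 < η₁ := by linarith only [hη₁]
  obtain ⟨T₁, hT₁, hT₁T, hT₁p⟩ := hE.exists_forall_packing_lt hT hσ hη₁half hpack0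
  have hV1pack : ∀ x, V 1 0 x * σ ^ 3 ≤ η₁ / 2 := fun x => by rw [hV1ρ, hdd1]; exact hpack0 x
  obtain ⟨T₁', hT₁', hT₁'T, hT₁'p⟩ := hV1sol.exists_forall_packing_lt hTst hσ hη₁half hV1pack
  have hone_pack : (1:ℝ) * σ ^ 3 ≤ η₁ / 2 := by
    have h4 : (1:ℝ) ≤ 4 * B ^ 2 := by nlinarith only [hB1]
    have := mul_le_mul_of_nonneg_right h4 hσ3pos.le
    linarith only [this, hσ3]
  have hV0pack : ∀ x, V 0 0 x * σ ^ 3 ≤ η₁ / 2 := fun x => by rw [hV0ρ, hdd0]; exact hone_pack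
  obtain ⟨T₃, hT₃, hT₃T, hT₃p⟩ := hV0sol.exists_forall_packing_lt hTst hσ hη₁half hV0pack
  obtain ⟨T₂, hT₂_def⟩ : ∃ T₂ : ℝ, T₂ = min (min T₁ T₁') T₃ := ⟨_, rfl⟩
  have hT₂ : 0 < T₂ := hT₂_def ▸ lt_min (lt_min hT₁ hT₁') hT₃
  have hT₂T₁ : T₂ ≤ T₁ := hT₂_def ▸ (min_le_left _ _).trans (min_le_left _ _)
  have hT₂T₁' : T₂ ≤ T₁' := hT₂_def ▸ (min_le_left _ _).trans (min_le_right _ _)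
  have hT₂T₃ : T₂ ≤ T₃ := hT₂_def ▸ min_le_right _ _
  have hT₂T : T₂ ≤ T := hT₂T₁.trans hT₁T
  have hT₂Tst : T₂ ≤ Tst := hT₂T₃.trans hT₃T
  have hVeq : ∀ s ∈ Ico 0 T₂, V 1 s = ρ s ∧ uV 1 s = u s ∧ θV 1 s = θ s :=
    hU σ hσ T₂ (V 1) (θV 1) (uV 1) ρ θ u (isHardSphereEulerSolution_restrict hV1sol hT₂Tst) (isHardSphereEulerSolution_restrict hE hT₂T)
      (fun s hs x => (hT₁'p s ⟨hs.1, hs.2.trans_le hT₂T₁'⟩ x).le.trans hη₁leU)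
      (fun s hs x => (hT₁p s ⟨hs.1, hs.2.trans_le hT₂T₁⟩ x).le.trans hη₁leU)
      (by rw [hV1ρ, hdd1]) (by rw [hV1u, huu1, hu0']) (by rw [hV1θ, htt1, hθ0'])
  have hconst : IsHardSphereEulerSolution σ T₂ (fun _ _ => (1:ℝ)) (fun _ _ => (0:V3))
      (fun _ _ => (1:ℝ)) :=
    isHardSphereEulerSolutionDim_three_iff.1
      (IsHardSphereEulerSolutionDim.const σ T₂ (0:V3) one_pos one_pos)
  have hV0eq : ∀ s ∈ Ico 0 T₂, V 0 s = (fun _ => (1:ℝ)) ∧ uV 0 s = (fun _ => (0:V3)) ∧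
      θV 0 s = (fun _ => (1:ℝ)) :=
    hU σ hσ T₂ (V 0) (θV 0) (uV 0) (fun _ _ => (1:ℝ)) (fun _ _ => (1:ℝ)) (fun _ _ => (0:V3))
      (isHardSphereEulerSolution_restrict hV0sol hT₂Tst) hconst
      (fun s hs x => (hT₃p s ⟨hs.1, hs.2.trans_le hT₂T₃⟩ x).le.trans hη₁leU)
      (fun s hs x => by
        show (1:ℝ) * σ ^ 3 ≤ η₁U
        linarith only [hone_pack, hη₁half, hη₁leU])
      (by rw [hV0ρ, hdd0]) (by rw [hV0u, huu0]) (by rw [hV0θ, htt0])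
  -- Step 4: the time `T'`, the slow-down factor `λ₀`, plateau functions
  obtain ⟨T', hT'_def⟩ : ∃ T' : ℝ, T' = (t + T) / 2 := ⟨_, rfl⟩
  have htT' : t < T' := by rw [hT'_def]; linarith only [ht.2]
  have hT'T : T' < T := by rw [hT'_def]; linarith only [ht.2]
  have hT'pos : 0 < T' := ht.1.trans_lt htT'
  obtain ⟨l0, hl0_def⟩ : ∃ l0 : ℝ, l0 = min (1 / 2) (T₂ / (2 * T')) := ⟨_, rfl⟩
  have h2T' : 0 < 2 * T' := mul_pos two_pos hT'pos
  have hl0pos : 0 < l0 := hl0_def ▸ lt_min (by norm_num) (div_pos hT₂ h2T')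
  have hl0half : l0 ≤ 1 / 2 := hl0_def ▸ min_le_left _ _
  have hl0one : l0 ≤ 1 := by linarith only [hl0half]
  have hl0T : l0 * T' ≤ T₂ / 2 := by
    have h : l0 ≤ T₂ / (2 * T') := hl0_def ▸ min_le_right _ _
    rw [le_div_iff₀ h2T'] at h; linarith only [h]
  have hl0s : ∀ s ∈ Ico (0:ℝ) T', l0 * s ∈ Ico (0:ℝ) T₂ := fun s hs =>
    ⟨mul_nonneg hl0pos.le hs.1, by
      have := mul_lt_mul_of_pos_left hs.2 hl0pos; linarith only [this, hl0T, hT₂]⟩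
  have h0T₂ : (0:ℝ) ∈ Ico 0 T₂ := ⟨le_rfl, hT₂⟩
  -- plateau functions
  have hm01 : ∀ κ, mfun κ ∈ Icc (0:ℝ) 1 := mfun_mem
  have hlampos : ∀ κ, 0 < lfun l0 κ := fun κ => hl0pos.trans_le (lfun_ge hl0one κ)
  have hlamle : ∀ κ, lfun l0 κ ≤ 1 := lfun_le_one hl0one
  -- Step 5: the profiles and the family
  obtain ⟨c, hc_def⟩ : ∃ c : ℝ, c = (Real.exp μ₁)⁻¹ := ⟨_, rfl⟩
  have hcpos : 0 < c := hc_def ▸ inv_pos.2 (Real.exp_pos μ₁)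
  have hcexp : Real.exp μ₁ * c = 1 := by rw [hc_def, mul_inv_cancel₀ (Real.exp_pos μ₁).ne']
  obtain ⟨A, hA_def⟩ : ∃ A : ℝ → T3 → ℝ, A = fun κ x => c * Ginv (dd (mfun κ) x) := ⟨_, rfl⟩
  obtain ⟨Θ, hΘ_def⟩ : ∃ Θ : ℝ → T3 → ℝ, Θ = fun κ x => lfun l0 κ ^ 2 * tt (mfun κ) x := ⟨_, rfl⟩
  obtain ⟨U, hU_def⟩ : ∃ U : ℝ → T3 → V3, U = fun κ x => lfun l0 κ • uu (mfun κ) x := ⟨_, rfl⟩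
  obtain ⟨Rh, hRh_def⟩ : ∃ Rh : ℝ → ℝ → T3 → ℝ, Rh = fun κ =>
      if κ ≤ 5 / 8 then (fun s x => V (mfun κ) (l0 * s) x)
      else (fun s x => ρ (lfun l0 κ * s) x) := ⟨_, rfl⟩
  obtain ⟨Uh, hUh_def⟩ : ∃ Uh : ℝ → ℝ → T3 → V3, Uh = fun κ =>
      if κ ≤ 5 / 8 then (fun s x => l0 • uV (mfun κ) (l0 * s) x)
      else (fun s x => lfun l0 κ • u (lfun l0 κ * s) x) := ⟨_, rfl⟩
  obtain ⟨Th, hTh_def⟩ : ∃ Th : ℝ → ℝ → T3 → ℝ, Th = fun κ =>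
      if κ ≤ 5 / 8 then (fun s x => l0 ^ 2 * θV (mfun κ) (l0 * s) x)
      else (fun s x => lfun l0 κ ^ 2 * θ (lfun l0 κ * s) x) := ⟨_, rfl⟩
  -- values of `dd ∘ mfun`, `Ginv`, and the activity bounds
  have hddI : ∀ κ x, dd (mfun κ) x ∈ Icc (0:ℝ) (4 * B ^ 2) := fun κ x =>
    ⟨(hddpos _ (hm01 κ) x).le, (hddb _ (hm01 κ) x).2.trans (hρ₀le xhi)⟩
  have hrng8 : ∀ x, Real.exp μ₁ * a₁ x ∈ Icc (0:ℝ) (8 * B ^ 2) := fun x =>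
    ⟨(hμ₁rng x).1, (hμ₁rng x).2.trans h2B8⟩
  have hGinv_mono : ∀ y₁ ∈ Icc (0:ℝ) (4 * B ^ 2), ∀ y₂ ∈ Icc (0:ℝ) (4 * B ^ 2), y₁ ≤ y₂ →
      Ginv y₁ ≤ Ginv y₂ := fun y₁ hy₁ y₂ hy₂ h =>
    ginv_monotone hGmono (hGGinv y₁ hy₁) (hGGinv y₂ hy₂) h
  have hGinvlo : Ginv (ρ 0 xlo) = Real.exp μ₁ * a₁ xlo := by rw [hρ₀G]; exact hGinvG _ (hrng8 xlo)
  have hGinvhi : Ginv (ρ 0 xhi) = Real.exp μ₁ * a₁ xhi := by rw [hρ₀G]; exact hGinvG _ (hrng8 xhi)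
  have hAb : ∀ κ x, a₁ xlo ≤ A κ x ∧ A κ x ≤ a₁ xhi := by
    intro κ x
    have hlo := hGinv_mono _ hρloI _ (hddI κ x) (hddb _ (hm01 κ) x).1
    have hhi := hGinv_mono _ (hddI κ x) _ hρhiI (hddb _ (hm01 κ) x).2
    rw [hGinvlo] at hlo
    rw [hGinvhi] at hhi
    rw [hA_def]
    constructor
    · calc a₁ xlo = c * (Real.exp μ₁ * a₁ xlo) := by
            rw [← mul_assoc, mul_comm c, hcexp, one_mul]
        _ ≤ c * Ginv (dd (mfun κ) x) := mul_le_mul_of_nonneg_left hlo hcpos.le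
    · calc c * Ginv (dd (mfun κ) x) ≤ c * (Real.exp μ₁ * a₁ xhi) :=
            mul_le_mul_of_nonneg_left hhi hcpos.le
        _ = a₁ xhi := by rw [← mul_assoc, mul_comm c, hcexp, one_mul]
  have hApos : ∀ κ x, 0 < A κ x := fun κ x => (ha₁ xlo).trans_le (hAb κ x).1
  have hAB : ∀ κ x, B⁻¹ ≤ A κ x ∧ A κ x ≤ B := fun κ x =>
    ⟨(haB xlo).1.trans (hAb κ x).1, (hAb κ x).2.trans (haB xhi).2⟩
  have hΘpos : ∀ κ x, 0 < Θ κ x := fun κ x => by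
    rw [hΘ_def]; exact mul_pos (pow_pos (hlampos κ) 2) (httpos _ (hm01 κ) x)
  -- the key identity `G (e^{μ₁} A κ x) = dd (mfun κ) x`
  have hGA : ∀ κ x, Real.exp μ₁ * A κ x = Ginv (dd (mfun κ) x) := fun κ x => by
    rw [hA_def]; simp only; rw [← mul_assoc, hcexp, one_mul]
  have hGAdd : ∀ κ x, G (Real.exp μ₁ * A κ x) = dd (mfun κ) x := fun κ x => by
    rw [hGA]; exact (hGGinv _ (hddI κ x)).1
  have hGAI : ∀ κ x, Real.exp μ₁ * A κ x ∈ Icc (0:ℝ) (8 * B ^ 2) := fun κ x => by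
    rw [hGA]; exact (hGGinv _ (hddI κ x)).2
  -- Step 6: smoothness of the profile paths
  have hmS : ContDiffOn ℝ ∞ mfun (Icc 0 1) := mfun_contDiff.contDiffOn
  have h1mS : ContDiffOn ℝ ∞ (fun κ => 1 - mfun κ) (Icc 0 1) :=
    (contDiff_const.sub mfun_contDiff).contDiffOn
  have hlamS : ContDiffOn ℝ ∞ (lfun l0) (Icc 0 1) := (lfun_contDiff l0).contDiffOn
  have hlam2S : ContDiffOn ℝ ∞ (fun κ => lfun l0 κ ^ 2) (Icc 0 1) := ((lfun_contDiff l0).pow 2).contDiffOn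
  have hddmS : Torus.IsSmoothSpaceTimeOn (Icc 0 1) (fun κ x => dd (mfun κ) x) := by
    have h := (Torus.isSmoothSpaceTimeOn_of_time h1mS).add
      ((Torus.isSmoothSpaceTimeOn_of_time hmS).mul (Torus.isSmoothSpaceTimeOn_const hsρ0 (Icc 0 1)))
    rw [hdd_def]; exact h
  have httmS : Torus.IsSmoothSpaceTimeOn (Icc 0 1) (fun κ x => tt (mfun κ) x) := by
    have h := (Torus.isSmoothSpaceTimeOn_of_time h1mS).add
      ((Torus.isSmoothSpaceTimeOn_of_time hmS).mul (Torus.isSmoothSpaceTimeOn_const hθ₁s (Icc 0 1)))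
    rw [htt_def]; exact h
  have huumS : Torus.IsSmoothSpaceTimeOn (Icc 0 1) (fun κ x => uu (mfun κ) x) := by
    have h := (Torus.isSmoothSpaceTimeOn_of_time hmS).smul (Torus.isSmoothSpaceTimeOn_const hu₁s (Icc 0 1))
    rw [huu_def]; exact h
  have hAs : Torus.IsSmoothSpaceTimeOn (Icc 0 1) A := by
    have hG' : Torus.IsSmoothSpaceTimeOn (Icc 0 1) (fun κ x => Ginv (dd (mfun κ) x)) :=
      hddmS.comp_contDiffOn hGinvs fun κ _ x =>
        ⟨by linarith only [(hddI κ x).1], (hddI κ x).2.trans_lt (by linarith only [hB2])⟩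
    rw [hA_def]
    exact (Torus.isSmoothSpaceTimeOn_of_time contDiffOn_const).mul hG'
  have hΘs : Torus.IsSmoothSpaceTimeOn (Icc 0 1) Θ := by
    rw [hΘ_def]; exact (Torus.isSmoothSpaceTimeOn_of_time hlam2S).mul httmS
  have hUs : Torus.IsSmoothSpaceTimeOn (Icc 0 1) U := by
    rw [hU_def]; exact (Torus.isSmoothSpaceTimeOn_of_time hlamS).smul huumS
  have hAc : ∀ κ ∈ Icc (0:ℝ) 1, Continuous (A κ) := fun κ hκ => (hAs.isSmooth_slice hκ).continuous
  have hΘc : ∀ κ ∈ Icc (0:ℝ) 1, Continuous (Θ κ) := fun κ hκ => (hΘs.isSmooth_slice hκ).continuous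
  have hUc : ∀ κ ∈ Icc (0:ℝ) 1, Continuous (U κ) := fun κ hκ => (hUs.isSmooth_slice hκ).continuous
  -- Step 7: the members are solutions on `[0, T')`
  have hT'A : T' ≤ Tst / l0 := by
    rw [le_div_iff₀ hl0pos]; linarith only [hl0T, hT₂Tst, hT₂]
  have hT'B : ∀ κ, T' ≤ T / lfun l0 κ := fun κ => by
    rw [le_div_iff₀ (hlampos κ)]
    have := mul_le_mul_of_nonneg_left (hlamle κ) hT'pos.le
    linarith only [this, hT'T]
  have hsolA : ∀ κ, κ ≤ 5 / 8 → IsHardSphereEulerSolution σ T' (Rh κ) (Uh κ) (Th κ) := by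
    intro κ hκ
    rw [hRh_def, hUh_def, hTh_def]
    simp only [if_pos hκ]
    exact isHardSphereEulerSolution_restrict (hSc σ Tst l0 (V (mfun κ)) (θV (mfun κ)) (uV (mfun κ))
      hl0pos (hVsol _ (hm01 κ)).1) hT'A
  have hsolB : ∀ κ, ¬ κ ≤ 5 / 8 → IsHardSphereEulerSolution σ T' (Rh κ) (Uh κ) (Th κ) := by
    intro κ hκ
    rw [hRh_def, hUh_def, hTh_def]
    simp only [if_neg hκ]
    exact isHardSphereEulerSolution_restrict (hSc σ T (lfun l0 κ) ρ θ u (hlampos κ) hE) (hT'B κ)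
  have hsol : ∀ κ ∈ Icc (0:ℝ) 1, IsHardSphereEulerSolution σ T' (Rh κ) (Uh κ) (Th κ) := by
    intro κ _
    by_cases hκ : κ ≤ 5 / 8
    · exact hsolA κ hκ
    · exact hsolB κ hκ
  -- Step 8: joint smoothness in `(κ, s, x)` by the two charts
  have hsρ : ContDiffOn ℝ ((⊤ : ℕ∞) : WithTop ℕ∞)
      (fun q : ℝ × ℝ × EuclideanSpace ℝ (Fin 3) => Rh q.1 q.2.1 (Torus.proj q.2.2))
      (Icc 0 1 ×ˢ (Ico 0 T' ×ˢ univ)) :=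
    family_contDiffOn V ρ (fun (_ : ℝ) (r : ℝ) => r) Rh contDiff_snd hVρs hE.smooth_density
      hl0pos hl0one hT₂Tst hT'T hl0s (fun s hs => (hVeq s hs).1)
      (fun κ s x => by simp only [hRh_def]; split_ifs <;> rfl)
  have hsu : ContDiffOn ℝ ((⊤ : ℕ∞) : WithTop ℕ∞)
      (fun q : ℝ × ℝ × EuclideanSpace ℝ (Fin 3) => Uh q.1 q.2.1 (Torus.proj q.2.2))
      (Icc 0 1 ×ˢ (Ico 0 T' ×ˢ univ)) :=
    family_contDiffOn uV u (fun (l : ℝ) (v : V3) => l • v) Uh (contDiff_fst.smul contDiff_snd)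
      hVus hE.smooth_velocity hl0pos hl0one hT₂Tst hT'T hl0s (fun s hs => (hVeq s hs).2.1)
      (fun κ s x => by simp only [hUh_def]; split_ifs <;> rfl)
  have hsθ : ContDiffOn ℝ ((⊤ : ℕ∞) : WithTop ℕ∞)
      (fun q : ℝ × ℝ × EuclideanSpace ℝ (Fin 3) => Th q.1 q.2.1 (Torus.proj q.2.2))
      (Icc 0 1 ×ˢ (Ico 0 T' ×ˢ univ)) :=
    family_contDiffOn θV θ (fun (l : ℝ) (r : ℝ) => l ^ 2 * r) Th
      ((contDiff_fst.pow 2).mul contDiff_snd) hVθs hE.smooth_temperature hl0pos hl0one hT₂Tst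
      hT'T hl0s (fun s hs => (hVeq s hs).2.2) (fun κ s x => by simp only [hTh_def]; split_ifs <;> rfl)
  -- Step 9: time-0 slices of the family and the LLN clause
  have hRh0 : ∀ κ, Rh κ 0 = dd (mfun κ) := by
    intro κ
    by_cases hκ : κ ≤ 5 / 8
    · rw [hRh_def]; simp only [if_pos hκ, mul_zero]
      exact (hVsol _ (hm01 κ)).2.1
    · rw [hRh_def]; simp only [if_neg hκ, mul_zero]
      push Not at hκ
      rw [mfun_eq_one (by linarith only [hκ]), hdd1]
  have hUh0 : ∀ κ, Uh κ 0 = U κ := by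
    intro κ
    by_cases hκ : κ ≤ 5 / 8
    · rw [hUh_def, hU_def]; simp only [if_pos hκ, mul_zero]
      funext x
      rw [(hVsol _ (hm01 κ)).2.2.1, lfun_eq_of_le (by linarith only [hκ])]
    · rw [hUh_def, hU_def]; simp only [if_neg hκ, mul_zero]
      push Not at hκ
      funext x
      rw [hu0', mfun_eq_one (by linarith only [hκ]), huu1]
  have hTh0 : ∀ κ, Th κ 0 = Θ κ := by
    intro κ
    by_cases hκ : κ ≤ 5 / 8
    · rw [hTh_def, hΘ_def]; simp only [if_pos hκ, mul_zero]
      funext x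
      rw [(hVsol _ (hm01 κ)).2.2.2, lfun_eq_of_le (by linarith only [hκ])]
    · rw [hTh_def, hΘ_def]; simp only [if_neg hκ, mul_zero]
      push Not at hκ
      funext x
      rw [hθ0', mfun_eq_one (by linarith only [hκ]), htt1]
  have hddc : ∀ κ, Continuous (dd (mfun κ)) := fun κ => by
    rw [hdd_def]; exact continuous_const.add (continuous_const.mul hρ₀c)
  have hlln : ∀ κ ∈ Icc (0:ℝ) 1,
      TendstoHydroFieldsAt (fun N => localGibbsLaw σ (A κ) (U κ) (Θ κ) N (Φ N)) Φ
        (Rh κ) (Uh κ) (Th κ) 0 := fun κ hκ =>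
    lln_member Φ hGmono hGc h2B8 hprof (hAc κ hκ) (hΘc κ hκ) (hUc κ hκ) (hAB κ) (hΘpos κ)
      (hApos κ) (hGAI κ) (hGAdd κ) (hddc κ) (hdd_int _) (hRh0 κ) (hUh0 κ) (hTh0 κ)
  -- Step 10: collect the clauses
  refine ⟨T', htT', A, Θ, U, Rh, Th, Uh, hAs, hΘs, hUs, ?_, ?_, ?_, ?_, ?_, hsol, hsρ, hsu, hsθ,
    hlln, ?_, ?_, ?_, ?_, ?_⟩
  · -- hull (Λ = 1) and positivity of the temperature profile
    intro κ _ x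
    refine ⟨?_, ?_, hΘpos κ x⟩
    · rw [inv_one, one_mul]; exact (ciInf_le hbddb xlo).trans (hAb κ x).1
    · rw [one_mul]; exact (hAb κ x).2.trans (le_ciSup hbdda xhi)
  · -- κ = 0: constant profiles
    intro x
    rw [hA_def, hΘ_def, hU_def]
    refine ⟨?_, ?_, ?_⟩ <;> simp only [mfun_zero, hdd0, htt0, huu0]
  · -- a 1 = a₁
    rw [hA_def]
    funext x
    simp only [mfun_eq_one (by norm_num : (1:ℝ) / 2 ≤ 1), hdd1]
    rw [hρ₀G, hGinvG _ (hrng8 x), ← mul_assoc, mul_comm c, hcexp, one_mul]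
  · -- θ₀ 1 = θ₁
    rw [hΘ_def]
    funext x
    simp only [mfun_eq_one (by norm_num : (1:ℝ) / 2 ≤ 1), htt1, lfun_one, one_pow, one_mul]
  · -- u₀ 1 = u₁
    rw [hU_def]
    funext x
    simp only [mfun_eq_one (by norm_num : (1:ℝ) / 2 ≤ 1), huu1, lfun_one, one_smul]
  · -- probability
    intro κ hκ N
    exact isProbabilityMeasure_localGibbsLaw (hAc κ hκ) (hΘc κ hκ) (hUc κ hκ) (hApos κ) (hΘpos κ)
      hσhalf N (Φ N)
  · -- ρh 1 = ρ
    rw [hRh_def]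
    simp only [show ¬ ((1:ℝ) ≤ 5 / 8) by norm_num, if_false, lfun_one, one_mul]
  · -- uh 1 = u
    rw [hUh_def]
    simp only [show ¬ ((1:ℝ) ≤ 5 / 8) by norm_num, if_false, lfun_one, one_mul, one_smul]
  · -- θh 1 = θ
    rw [hTh_def]
    simp only [show ¬ ((1:ℝ) ≤ 5 / 8) by norm_num, if_false, lfun_one, one_pow, one_mul]
  · -- the κ = 0 member is constant in space-time on [0, T')
    intro s hs x
    obtain ⟨e1, e2, e3⟩ := hV0eq (l0 * s) (hl0s s hs)
    obtain ⟨f1, f2, f3⟩ := hV0eq 0 h0T₂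
    rw [hRh_def, hUh_def, hTh_def]
    simp only [show ((0:ℝ) ≤ 5 / 8) by norm_num, if_true, mfun_zero, mul_zero]
    rw [e1, e2, e3, f1, f2, f3]
    exact ⟨rfl, rfl, rfl⟩

/-- **THE DOOR (both provable pieces discharged, [U] = the tree theorem
`hsEuler_uniqueness_smallPacking` used by name): `PreShockHomotopy ⟸ [WD] ∧ [S]`**, with
`[E]` = `coolSlowScaling_holds` (`PreShockDoorScaling`) and `[I]` = `llnDataIdentification_holds`
(`PreShockDoorPieces`). -/
theorem preShockHomotopy_door (hWD : SmoothFamilyWellposedness) (hSt : LocalEosStatics) :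
    Summit.AtomisticToContinuum.HydrodynamicLimit.Theses.OneSphereInfluence.PreShockHomotopy :=
  preShockHomotopy_of hWD coolSlowScaling_holds hSt llnDataIdentification_holds

end Summit.AtomisticToContinuum.HydrodynamicLimit.Theorems.PreShockDoor

end
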